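import Literature.NumberTheory.Rogawski1990.ArchTransfFamilyJumpKit      -- PART 2a (LH7-p02 (g2)): jump calculus, `perm_fin_three_eq`, `slotPerm_update_one`, covered slot signs, the normal curve; brings ★ Resolved, ★ A1, ★ `ArchHCSpaceG`
import HarnessLib

/-!
# (I₃) for the candidate transfer family — PART 2b (PARTNERS): the compact reflection flips `'F`; the six partner classes at a covered wall — four jump by
# `± jc′₀₂·'F_{S″}(cayPt)`, two are continuous; `κ_{ρ′σ} = sign σ·κ_{ρ′}`; the resolved partner sum jumps by `4·jc′₀₂·Σ″(cayPt)` (Shelstad 1979 Lemma 4.3, Prop. 4.5, Thm. 4.7 (IIIb); Bouaziz 1994 (I₃))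

Topic `NumberTheory/Rogawski1990`; namespace `Literature.NumberTheory.Rogawski1990`.  THEOREMS ONLY (no `def`, no instance, no notation, no axiom, no named fact, no `sorry`).
Cell `pub/hodgecm-mathlib`, line LH3 (closer stub `stub_N9`, crux H413 = `stmt-HodgeConjecture-24833`), organ **O-L2 (I₃-TRANSF)** ED. 1 (LH3-plan (g3) DEALER BOARD g3 #1 (iv),
RULING #2; author LH7-p02 (g2)).  THE MATHEMATICS.  `w₀ ∉ S` covered, `p` a `G`-semiregular point of the `H`-wall at `w₀` (`p_{w₀0} = p_{w₀2}`, `e^{ip_{w₀1}} ≠ e^{ip_{w₀0}}`, `G`-regular at the other compact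
places, off the real walls), `F ∈ ArchHCSpaceG (slotSign L α) jc′`, `'F_S = archERhoG S · F S`.  §3′ (W) + the ALTERNATION of the Weyl denominator (★ A1
`archERhoG_mul_archRG_slotPerm`) give `'F_S(swap₀₁ c) = −'F_S(c)` wherever `archRG S c ≠ 0`.  §4: for the pure relabelling `σ ∈ S₃` at `w₀`, `ν ↦ 'F_S(σ·(p + ν•nrm w₀))` has
one-sided limits at `0` with jump `sign σ · jc′ S w₀ 0 2 · 'F_{S″}(cayPt w₀ p)` if `σ⁻¹1 ≠ 2` (`σ = 1`: HC's (I₃) at order `0`, ★ `ArchHcJump.order_zero`; `(02)`: the reflected curve;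
`(01)`, `(012)`: minus those, by §3′ off `ν = 0`), and jump `0` if `σ⁻¹1 = 2` (the colliding pair sits on the COMPACT slots `(0,1)`: continuous by (I₁) on ★ `InRegG`).  §5: on the
jumping classes `κ_{ρ′σ} = sign σ · κ_{ρ′}` (the slot constant reads `slotSign (σ⁻¹1) = slotSign 1`), so EVERY jumping partner contributes `+κ_{ρ′}·jc′₀₂·'F_{S″}(ρ′·cayPt w₀ p)`
and the resolved partner sum `Σ_ρ κ_ρ·'F_S(ρ·(p + ν•nrm w₀))` jumps by `4 · jc′ S w₀ 0 2 · Σ_{ρ′ ∈ partnerPerms (insert w₀ S)} κ_{ρ′}·'F_{S″}(ρ′·cayPt w₀ p)`.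
HONEST LABEL: HC_CM is proved only modulo the 7 printed citations (2 remaining:
hLiu418 = `stmt-HodgeConjecture-24832`, h413 = `stmt-HodgeConjecture-24833`) until rung 0 closes; count-neutral.

## References
* [Shelstad1979] D. Shelstad, *Characters and inner forms of a quasi-split group over ℝ*, Compositio Math. 39 (1979), §4: Lemma 4.2 p. 23, Lemma 4.3 p. 25, Prop. 4.5 p. 26,
  Thm. 4.7 (IIIb) p. 31.
* [Bouaziz1994IntegralesOrbitales] A. Bouaziz, *Intégrales orbitales sur les groupes de Lie réductifs*, Ann. Sci. ÉNS 27 (1994), §3.2 (I₁)–(I₃) pp. 579–580, §6.2 p. 591, Rem. 2 p. 594.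
* [Rogawski1990] J. D. Rogawski, *Automorphic Representations of Unitary Groups in Three Variables* (1990), §3.6 p. 31, §4.3 (4.3.1) p. 43, §8.2 pp. 119–123, §14.2 p. 232.
* [Varadarajan1977] V. S. Varadarajan, *Harmonic Analysis on Real Reductive Groups*, LNM 576 (1977), Part I §1.12.
-/

set_option autoImplicit false

noncomputable section

open NumberField NumberField.InfinitePlace Complex Set Filter Topology Equiv Finset
open scoped Classical Real ContDiff
open Literature.NumberTheory.Automorphic Literature.NumberTheory.Automorphic.UnitaryGroup Literature.NumberTheory.Automorphic.ArchCartan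
open Literature.NumberTheory.Automorphic.Shelstad1979.StableOrbitalIntegrals
open Literature.NumberTheory.GaloisRepresentations

namespace Literature.NumberTheory.Rogawski1990

/-! ## §3′ The compact reflection flips the twisted family -/

section Reflection

variable (L : Type) [Field L] [NumberField L] [IsCMField L] (α : Fin 3 → L)

omit [IsCMField L] in
/-- **The compact reflection FLIPS the twisted family**: under HC's (W) clause, at a compact place `w₀ ∉ S` with `slotSign w₀ 0 = slotSign w₀ 1`, for `archRG S c ≠ 0`:
`'F_S(swap₀₁ c) = −'F_S(c)`, `'F_S = archERhoG S · F S` ((W) gives `F(swap c)·R′(c) = R′(swap c)·F(c)`; the Weyl denominator `archERhoG·archRG` ALTERNATES,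
★ `archERhoG_mul_archRG_slotPerm`). [cite: Shelstad1979, §4 p. 23] [cite: Bouaziz1994IntegralesOrbitales, §6.2 p. 591] -/
theorem twisted_hcSwapAt_zero_one {S : Finset {w : InfinitePlace L // IsComplex w}} {w₀ : {w : InfinitePlace L // IsComplex w}} (hw₀ : w₀ ∉ S)
    (h01 : slotSign L α w₀ 0 = slotSign L α w₀ 1)
    {F : Finset {w : InfinitePlace L // IsComplex w} → ({w : InfinitePlace L // IsComplex w} → Fin 3 → ℝ) → ℂ} (hW : ArchHcWeyl (slotSign L α) F)
    {c : {w : InfinitePlace L // IsComplex w} → Fin 3 → ℝ} (hc : archRG S c ≠ 0) :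
    archERhoG S (hcSwapAt w₀ 0 1 c) * F S (hcSwapAt w₀ 0 1 c) = -(archERhoG S c * F S c) := by
  have hmem : Function.update (1 : {w : InfinitePlace L // IsComplex w} → Perm (Fin 3)) w₀ (swap 0 1) ∈ partnerPerms S :=
    (mem_partnerPerms_iff S _).2 fun w hw => by rw [Function.update_of_ne (by rintro rfl; exact hw₀ hw), Pi.one_apply]
  have hsw : slotPerm (Function.update (1 : {w : InfinitePlace L // IsComplex w} → Perm (Fin 3)) w₀ (swap 0 1)) c = hcSwapAt w₀ 0 1 c :=
    slotPerm_update_one w₀ (swap 0 1) c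
  have halt := archERhoG_mul_archRG_slotPerm hmem c
  have hsign : (∏ w, (Equiv.Perm.sign ((Function.update (1 : {w : InfinitePlace L // IsComplex w} → Perm (Fin 3)) w₀ (swap 0 1)) w) : ℂ)) = -1 := by
    have h := prod_sign_update_swap_mul (1 : {w : InfinitePlace L // IsComplex w} → Perm (Fin 3)) w₀ (show (0 : Fin 3) ≠ 1 by decide)
    simpa using h
  rw [hsw, hsign] at halt
  have hWeq := hW.1 S c w₀ 0 1 hw₀ (by decide) h01
  have hE : archERhoG S c ≠ 0 := archERhoG_ne_zero' S c
  refine mul_right_cancel₀ (mul_ne_zero hE hc) ?_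
  linear_combination (archERhoG S (hcSwapAt w₀ 0 1 c) * archERhoG S c) * hWeq + (archERhoG S c * F S c) * halt

end Reflection

/-! ## §4 The six partner classes at the covered place: four jump by `± jc′₀₂·'F_{S″}(cayPt)`, two are continuous -/

section Six

variable (L : Type) [Field L] [NumberField L] [IsCMField L] (α : Fin 3 → L)

omit [NumberField L] [IsCMField L] in
/-- **A compact-pair partner of a semiregular wall point lies in `T_{in-reg}(G′)`**: if the relabelling `σ` at `w₀` puts eigenvalues equal to `e^{ip_{w₀0}}` on the slots `0, 1`
(same sign at a covered place) and `p_{w₀1}` on slot `2`, then `slotPerm (update 1 w₀ σ) p ∈ InRegG (slotSign L α) S`. [cite: Bouaziz1994IntegralesOrbitales, §6.2 p. 591]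
[cite: Shelstad1979, §4 p. 23] -/
theorem slotPerm_update_one_mem_inRegG {S : Finset {w : InfinitePlace L // IsComplex w}} {w₀ : {w : InfinitePlace L // IsComplex w}}
    (h10 : slotSign L α w₀ 1 = slotSign L α w₀ 0) {p : {w : InfinitePlace L // IsComplex w} → Fin 3 → ℝ}
    (hs1 : Circle.exp (p w₀ 1) ≠ Circle.exp (p w₀ 0)) (hreg : ∀ v, v ∉ S → v ≠ w₀ → Function.Injective fun i : Fin 3 => Circle.exp (p v i))
    {σ : Perm (Fin 3)} (e0 : Circle.exp (p w₀ (σ 0)) = Circle.exp (p w₀ 0)) (e1 : Circle.exp (p w₀ (σ 1)) = Circle.exp (p w₀ 0)) (e2 : σ 2 = 1) :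
    slotPerm (Function.update (1 : {w : InfinitePlace L // IsComplex w} → Perm (Fin 3)) w₀ σ) p ∈ InRegG (slotSign L α) S := by
  intro w hw i j hij hsij
  rw [slotPerm_update_one]
  by_cases hw0 : w = w₀
  · subst hw0
    rw [Function.update_self, Function.comp_apply, Function.comp_apply]
    have key : ∀ l : Fin 3, Circle.exp (p w (σ l)) = Circle.exp (p w (if l = 2 then 1 else 0)) := by
      intro l
      fin_cases l
      · simpa using e0
      · simpa using e1
      · simp [e2]
    have hsl : ∀ l : Fin 3, l ≠ 2 → slotSign L α w l = slotSign L α w 0 := by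
      intro l hl
      fin_cases l
      · rfl
      · exact h10
      · exact absurd rfl hl
    rw [key i, key j]
    by_cases hi : i = 2 <;> by_cases hj : j = 2
    · exact absurd (hi.trans hj.symm) hij
    · rw [if_pos hi, if_neg hj]; exact hs1
    · rw [if_neg hi, if_pos hj]; exact hs1.symm
    · exact absurd ((hsl i hi).trans (hsl j hj).symm) hsij
  · rw [Function.update_of_ne hw0]
    exact fun h => hij (hreg w hw hw0 h)

omit [IsCMField L] in
/-- **Continuity of the twisted partner term through a tame point**: if `slotPerm τ p ∈ InRegG (slotSign L α) S`, then along the normal curve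
`ν ↦ archERhoG S (τ·(p + ν•nrm w₀)) · F S (τ·(p + ν•nrm w₀))` tends to its value at `ν = 0` ((I₁): `F S` is `C^∞` on the open ★ `InRegG`). [cite: Bouaziz1994IntegralesOrbitales, §3.2 (I₁) p. 579] -/
theorem tendsto_twisted_slotPerm_add_smul_nrm {S : Finset {w : InfinitePlace L // IsComplex w}}
    {F : Finset {w : InfinitePlace L // IsComplex w} → ({w : InfinitePlace L // IsComplex w} → Fin 3 → ℝ) → ℂ} (hI1 : ContDiffOn ℝ ∞ (F S) (InRegG (slotSign L α) S))
    (τ : {w : InfinitePlace L // IsComplex w} → Perm (Fin 3)) {p : {w : InfinitePlace L // IsComplex w} → Fin 3 → ℝ} (hp : slotPerm τ p ∈ InRegG (slotSign L α) S)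
    (w₀ : {w : InfinitePlace L // IsComplex w}) :
    Tendsto (fun ν : ℝ => archERhoG S (slotPerm τ (p + ν • nrm w₀)) * F S (slotPerm τ (p + ν • nrm w₀))) (𝓝 (0 : ℝ))
      (𝓝 (archERhoG S (slotPerm τ p) * F S (slotPerm τ p))) := by
  have hcurve : Continuous fun ν : ℝ => slotPerm τ (p + ν • nrm w₀) := (continuous_slotPerm τ).comp (continuous_const.add (continuous_id.smul continuous_const))
  have ht : Tendsto (fun ν : ℝ => slotPerm τ (p + ν • nrm w₀)) (𝓝 (0 : ℝ)) (𝓝 (slotPerm τ p)) := by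
    have h := hcurve.tendsto 0
    simpa only [zero_smul, add_zero] using h
  have hE : Continuous fun c : {w : InfinitePlace L // IsComplex w} → Fin 3 → ℝ => archERhoG S c := by
    simpa only [slotPerm_one] using (contDiff_archERhoG_slotPerm S (1 : {w : InfinitePlace L // IsComplex w} → Perm (Fin 3))).continuous
  have hFc : ContinuousAt (F S) (slotPerm τ p) := (hI1.continuousOn.continuousAt ((isOpen_inRegG _ S).mem_nhds hp))
  exact ((hE.tendsto _).comp ht).mul (hFc.tendsto.comp ht)

omit [IsCMField L] in
/-- **THE SIX PARTNER CLASSES AT A COVERED WALL (order `0`)**.  `S` admissible or not (not used), `w₀ ∉ S` covered, `p` a `G`-semiregular point of the `H`-wall at `w₀`, `F` in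
HC's space; for `σ ∈ S₃` the twisted family read on the `σ`-relabelled normal curve, `ν ↦ 'F_S(σ·(p + ν•nrm w₀))`, has one-sided limits at `0` with jump
`sign σ · jc′ S w₀ 0 2 · 'F_{S″}(cayPt w₀ p)` if `σ⁻¹ 1 ≠ 2` (the colliding pair sits on a NONCOMPACT slot pair: `σ = 1` reads `g(ν)`, `(02)` reads `g(−ν)`, `(01)` reads `−g(ν)`,
`(012)` reads `−g(−ν)`, `g` the `σ = 1` curve with HC jump (I₃)), and jump `0` if `σ⁻¹ 1 = 2` (compact pair: continuous by (I₁)).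
[cite: Shelstad1979, Lemma 4.3 p. 25; Prop. 4.5 p. 26; Thm. 4.7 (IIIb) p. 31] [cite: Bouaziz1994IntegralesOrbitales, §3.2 (I₃) p. 580] -/
theorem hasOneSidedJump_twisted_slotPerm_update_one (hα : ∀ i, α i ≠ 0) {S : Finset {w : InfinitePlace L // IsComplex w}}
    {w₀ : {w : InfinitePlace L // IsComplex w}} (hw₀ : w₀ ∉ S) (hcov : w₀ ∈ splitChartPlaces L α)
    {jc' : Finset {w : InfinitePlace L // IsComplex w} → {w : InfinitePlace L // IsComplex w} → Fin 3 → Fin 3 → ℂ}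
    {F : Finset {w : InfinitePlace L // IsComplex w} → ({w : InfinitePlace L // IsComplex w} → Fin 3 → ℝ) → ℂ} (hF : ArchHCSpaceG (slotSign L α) jc' F)
    {p : {w : InfinitePlace L // IsComplex w} → Fin 3 → ℝ} (hs02 : p w₀ 0 = p w₀ 2) (hs1 : Circle.exp (p w₀ 1) ≠ Circle.exp (p w₀ 0))
    (hreg : ∀ v, v ∉ S → v ≠ w₀ → Function.Injective fun i : Fin 3 => Circle.exp (p v i)) (hx : ∀ v ∈ S, p v 0 ≠ 0) (σ : Perm (Fin 3)) :
    HasOneSidedJump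
      (fun ν : ℝ => archERhoG S (slotPerm (Function.update (1 : {w : InfinitePlace L // IsComplex w} → Perm (Fin 3)) w₀ σ) (p + ν • nrm w₀)) *
        F S (slotPerm (Function.update (1 : {w : InfinitePlace L // IsComplex w} → Perm (Fin 3)) w₀ σ) (p + ν • nrm w₀)))
      (if σ.symm 1 ≠ 2 then (Equiv.Perm.sign σ : ℂ) * (jc' S w₀ 0 2 * (archERhoG (insert w₀ S) (cayPt w₀ p) * F (insert w₀ S) (cayPt w₀ p))) else 0) := by
  obtain ⟨h10, -, -⟩ := slotSign_of_mem_splitChartPlaces L α hα hcov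
  obtain ⟨h02, -⟩ := slotSign_zero_ne_two_of_mem_splitChartPlaces L α hα hcov
  have hsemi : HcSemireg S w₀ 0 2 p := ⟨hs02, by rw [show hcThird (0 : Fin 3) 2 = 1 from by decide]; exact hs1, hreg, hx⟩
  -- HC's jump of the `σ = 1` curve
  have hg : HasOneSidedJump (fun ν : ℝ => archERhoG S (p + ν • nrm w₀) * F S (p + ν • nrm w₀))
      (jc' S w₀ 0 2 * (archERhoG (insert w₀ S) (cayPt w₀ p) * F (insert w₀ S) (cayPt w₀ p))) := by
    have h := ArchHcJump.order_zero hF.2.2.2.2 hw₀ (show (0 : Fin 3) ≠ 2 by decide) h02 hsemi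
    rw [hcNrm_zero_two, hcCayPt_zero_two] at h
    exact h
  obtain ⟨hev, hevn⟩ := eventually_nhdsNE_mem_regG_add_smul_nrm hw₀ hs02 hs1 hreg hx
  have hrefl : ∀ ν : ℝ, slotPerm (Function.update (1 : {w : InfinitePlace L // IsComplex w} → Perm (Fin 3)) w₀ (swap 0 2)) (p + ν • nrm w₀) = p + (-ν) • nrm w₀ :=
    slotPerm_update_one_swap_zero_two_add_smul_nrm hs02
  have hI1 : ContDiffOn ℝ ∞ (F S) (InRegG (slotSign L α) S) := (hF.2.2.1 S).1
  rcases perm_fin_three_eq σ with rfl | rfl | rfl | rfl | rfl | rfl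
  · -- `σ = 1`: the curve itself
    have e1 : Function.update (1 : {w : InfinitePlace L // IsComplex w} → Perm (Fin 3)) w₀ 1 = 1 := by
      funext v; by_cases hv : v = w₀
      · subst hv; rw [Function.update_self, Pi.one_apply]
      · rw [Function.update_of_ne hv]
    rw [if_pos (by decide), Equiv.Perm.sign_one, Units.val_one, Int.cast_one, one_mul]
    simp only [e1, slotPerm_one]
    exact hg
  · -- `σ = (01)`: the compact reflection, `−g(ν)` off `ν = 0`
    rw [if_pos (by decide), Equiv.Perm.sign_swap (by decide), Units.val_neg, Units.val_one, Int.cast_neg, Int.cast_one]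
    refine HasOneSidedJump.jump_congr (hasOneSidedJump_congr_eventuallyEq (hasOneSidedJump_neg hg) ?_) (by ring)
    filter_upwards [hev] with ν hν
    rw [slotPerm_update_one]
    exact (twisted_hcSwapAt_zero_one L α hw₀ h10.symm hF.2.1 (archRG_ne_zero_of_mem_regG hν)).symm
  · -- `σ = (02)`: the reflected curve `g(−ν)`
    rw [if_pos (by decide), Equiv.Perm.sign_swap (by decide), Units.val_neg, Units.val_one, Int.cast_neg, Int.cast_one]
    simp only [hrefl]
    exact HasOneSidedJump.jump_congr (hasOneSidedJump_comp_neg hg) (by ring)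
  · -- `σ = (12)`: compact pair, continuous
    rw [if_neg (by decide)]
    refine hasOneSidedJump_zero_of_tendsto (tendsto_twisted_slotPerm_add_smul_nrm L α hI1 _ ?_ w₀)
    have e0 : Circle.exp (p w₀ ((swap (1 : Fin 3) 2) 0)) = Circle.exp (p w₀ 0) := by
      rw [Equiv.swap_apply_of_ne_of_ne (by decide) (by decide)]
    have e1 : Circle.exp (p w₀ ((swap (1 : Fin 3) 2) 1)) = Circle.exp (p w₀ 0) := by
      rw [Equiv.swap_apply_left, hs02]
    exact slotPerm_update_one_mem_inRegG L α h10 hs1 hreg e0 e1 (Equiv.swap_apply_right 1 2)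
  · -- `σ = (02)(01) = (0 1 2)`: `−g(−ν)` off `ν = 0`
    rw [if_pos (by decide), Equiv.Perm.sign_mul, Equiv.Perm.sign_swap (by decide), Equiv.Perm.sign_swap (by decide)]
    simp only [neg_mul, one_mul, neg_neg, Units.val_one, Int.cast_one]
    simp only [slotPerm_update_one_mul, hrefl]
    refine HasOneSidedJump.jump_congr (hasOneSidedJump_congr_eventuallyEq (hasOneSidedJump_neg (hasOneSidedJump_comp_neg hg)) ?_) (by ring)
    filter_upwards [hevn] with ν hν
    rw [slotPerm_update_one]
    exact (twisted_hcSwapAt_zero_one L α hw₀ h10.symm hF.2.1 (archRG_ne_zero_of_mem_regG hν)).symm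
  · -- `σ = (01)(02) = (0 2 1)`: compact pair, continuous
    rw [if_neg (by decide)]
    refine hasOneSidedJump_zero_of_tendsto (tendsto_twisted_slotPerm_add_smul_nrm L α hI1 _ ?_ w₀)
    have e0 : Circle.exp (p w₀ ((swap (0 : Fin 3) 1 * swap 0 2 : Perm (Fin 3)) 0)) = Circle.exp (p w₀ 0) := by
      rw [show (swap (0 : Fin 3) 1 * swap 0 2 : Perm (Fin 3)) 0 = 2 from by decide, hs02]
    have e1 : Circle.exp (p w₀ ((swap (0 : Fin 3) 1 * swap 0 2 : Perm (Fin 3)) 1)) = Circle.exp (p w₀ 0) := by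
      rw [show (swap (0 : Fin 3) 1 * swap 0 2 : Perm (Fin 3)) 1 = 0 from by decide]
    have e2 : (swap (0 : Fin 3) 1 * swap 0 2 : Perm (Fin 3)) 2 = 1 := by decide
    exact slotPerm_update_one_mem_inRegG L α h10 hs1 hreg e0 e1 e2

end Six

/-! ## §5 The κ-constants of the four jumping classes; the partner sum jumps by `4·jc′₀₂·Σ″(cayPt)` -/

section Kappa

variable (L : Type) [Field L] [NumberField L] [IsCMField L] (α : Fin 3 → L)

omit [IsCMField L] in
/-- **`κ_{ρ} = sign(ρ w₀) · κ_{ρ′}` on the jumping classes** (`ρ′ = update ρ w₀ 1`, `(ρ w₀)⁻¹ 1 ≠ 2`): the slot constant `K` reads the sign of the slot `(ρ w₀)⁻¹ 1 ∈ {0, 1}`, equal to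
that of slot `1` at a covered place (`slotSign 1 = slotSign 0`), and `Π sign` picks up `sign (ρ w₀)`. [cite: Rogawski1990, §4.3 (4.3.1) p. 43; §14.2 p. 232] [cite: Shelstad1979, Lemma 4.2 (p. 23)] -/
theorem kappa_eq_sign_mul_kappa_update {w₀ : {w : InfinitePlace L // IsComplex w}} (h10 : slotSign L α w₀ 1 = slotSign L α w₀ 0)
    (ρ : {w : InfinitePlace L // IsComplex w} → Perm (Fin 3)) (hA : (ρ w₀).symm 1 ≠ 2) :
    (((∏ w : {w : InfinitePlace L // IsComplex w},
        ((SignType.sign ((w.1.embedding (α (lineOf (formSign L α w) ((ρ w).symm 1)))).re) : ℤ) * archMajoritySign L (Matrix.diagonal α) w) : ℤ) : ℂ) *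
      ∏ w : {w : InfinitePlace L // IsComplex w}, (Equiv.Perm.sign (ρ w) : ℂ)) =
    (Equiv.Perm.sign (ρ w₀) : ℂ) *
      (((∏ w : {w : InfinitePlace L // IsComplex w},
          ((SignType.sign ((w.1.embedding (α (lineOf (formSign L α w) ((Function.update ρ w₀ 1 w).symm 1)))).re) : ℤ) * archMajoritySign L (Matrix.diagonal α) w) : ℤ) : ℂ) *
        ∏ w : {w : InfinitePlace L // IsComplex w}, (Equiv.Perm.sign (Function.update ρ w₀ 1 w) : ℂ)) := by
  have hslot : slotSign L α w₀ ((ρ w₀).symm 1) = slotSign L α w₀ ((1 : Perm (Fin 3)).symm 1) := by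
    have h3 : ∀ l : Fin 3, l ≠ 2 → l = 0 ∨ l = 1 := by decide
    rw [show (1 : Perm (Fin 3)).symm 1 = 1 from rfl]
    rcases h3 _ hA with h | h
    · rw [h, h10]
    · rw [h]
  have hK : (∏ w : {w : InfinitePlace L // IsComplex w},
        ((SignType.sign ((w.1.embedding (α (lineOf (formSign L α w) ((ρ w).symm 1)))).re) : ℤ) * archMajoritySign L (Matrix.diagonal α) w)) =
      ∏ w : {w : InfinitePlace L // IsComplex w},
        ((SignType.sign ((w.1.embedding (α (lineOf (formSign L α w) ((Function.update ρ w₀ 1 w).symm 1)))).re) : ℤ) * archMajoritySign L (Matrix.diagonal α) w) := by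
    refine Finset.prod_congr rfl fun w _ => ?_
    by_cases hw : w = w₀
    · subst hw
      rw [Function.update_self]
      change (slotSign L α w ((ρ w).symm 1) : ℤ) * _ = (slotSign L α w ((1 : Perm (Fin 3)).symm 1) : ℤ) * _
      rw [hslot]
    · rw [Function.update_of_ne hw]
  have hS : (∏ w : {w : InfinitePlace L // IsComplex w}, (Equiv.Perm.sign (ρ w) : ℂ)) =
      (Equiv.Perm.sign (ρ w₀) : ℂ) * ∏ w : {w : InfinitePlace L // IsComplex w}, (Equiv.Perm.sign (Function.update ρ w₀ 1 w) : ℂ) := by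
    rw [← Finset.mul_prod_erase Finset.univ _ (Finset.mem_univ w₀),
      ← Finset.mul_prod_erase Finset.univ (fun w => (Equiv.Perm.sign (Function.update ρ w₀ 1 w) : ℂ)) (Finset.mem_univ w₀), Function.update_self,
      Equiv.Perm.sign_one, Units.val_one, Int.cast_one, one_mul]
    congr 1
    exact Finset.prod_congr rfl fun w hw => by rw [Function.update_of_ne (Finset.ne_of_mem_erase hw)]
  rw [hK, hS]
  ring

omit [IsCMField L] in
/-- **ONE PARTNER TERM**: for `ρ ∈ partnerPerms S` the term `κ_ρ · 'F_S(ρ·(p + ν•nrm w₀))` of the resolved partner sum has one-sided limits at `ν = 0` with jump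
`jc′ S w₀ 0 2 · κ_{ρ′} · 'F_{S″}(ρ′·cayPt w₀ p)` (`ρ′ = update ρ w₀ 1`) if `(ρ w₀)⁻¹ 1 ≠ 2`, and `0` otherwise (§4 on the semiregular point `ρ′·p`; §5 `κ_ρ = sign(ρ w₀)·κ_{ρ′}`,
`sign² = 1`). [cite: Shelstad1979, Lemma 4.3 p. 25; Thm. 4.7 (IIIb) p. 31] [cite: Bouaziz1994IntegralesOrbitales, §3.2 (I₃) p. 580] -/
theorem hasOneSidedJump_kappa_twisted_partner (hα : ∀ i, α i ≠ 0) {S : Finset {w : InfinitePlace L // IsComplex w}}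
    {w₀ : {w : InfinitePlace L // IsComplex w}} (hw₀ : w₀ ∉ S) (hcov : w₀ ∈ splitChartPlaces L α)
    {jc' : Finset {w : InfinitePlace L // IsComplex w} → {w : InfinitePlace L // IsComplex w} → Fin 3 → Fin 3 → ℂ}
    {F : Finset {w : InfinitePlace L // IsComplex w} → ({w : InfinitePlace L // IsComplex w} → Fin 3 → ℝ) → ℂ} (hF : ArchHCSpaceG (slotSign L α) jc' F)
    {p : {w : InfinitePlace L // IsComplex w} → Fin 3 → ℝ} (hs02 : p w₀ 0 = p w₀ 2) (hs1 : Circle.exp (p w₀ 1) ≠ Circle.exp (p w₀ 0))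
    (hreg : ∀ v, v ∉ S → v ≠ w₀ → Function.Injective fun i : Fin 3 => Circle.exp (p v i)) (hx : ∀ v ∈ S, p v 0 ≠ 0)
    {ρ : {w : InfinitePlace L // IsComplex w} → Perm (Fin 3)} (hρ : ρ ∈ partnerPerms S) :
    HasOneSidedJump
      (fun ν : ℝ =>
        (((∏ w : {w : InfinitePlace L // IsComplex w},
            ((SignType.sign ((w.1.embedding (α (lineOf (formSign L α w) ((ρ w).symm 1)))).re) : ℤ) * archMajoritySign L (Matrix.diagonal α) w) : ℤ) : ℂ) *
          ∏ w : {w : InfinitePlace L // IsComplex w}, (Equiv.Perm.sign (ρ w) : ℂ)) *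
        (archERhoG S (slotPerm ρ (p + ν • nrm w₀)) * F S (slotPerm ρ (p + ν • nrm w₀))))
      (if (ρ w₀).symm 1 ≠ 2 then
        jc' S w₀ 0 2 *
          ((((∏ w : {w : InfinitePlace L // IsComplex w},
              ((SignType.sign ((w.1.embedding (α (lineOf (formSign L α w) ((Function.update ρ w₀ 1 w).symm 1)))).re) : ℤ) *
                archMajoritySign L (Matrix.diagonal α) w) : ℤ) : ℂ) *
            ∏ w : {w : InfinitePlace L // IsComplex w}, (Equiv.Perm.sign (Function.update ρ w₀ 1 w) : ℂ)) *
          (archERhoG (insert w₀ S) (slotPerm (Function.update ρ w₀ 1) (cayPt w₀ p)) * F (insert w₀ S) (slotPerm (Function.update ρ w₀ 1) (cayPt w₀ p))))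
       else 0) := by
  obtain ⟨h10, -, -⟩ := slotSign_of_mem_splitChartPlaces L α hα hcov
  have hρ' : Function.update ρ w₀ 1 ∈ partnerPerms (insert w₀ S) := update_one_mem_partnerPerms_insert w₀ hρ
  have h1 : Function.update ρ w₀ 1 w₀ = 1 := by rw [Function.update_self]
  obtain ⟨hs02', hs1', hreg', hx'⟩ := semireg_slotPerm hρ' hs02 hs1 hreg hx
  have hsix := hasOneSidedJump_twisted_slotPerm_update_one L α hα hw₀ hcov hF hs02' hs1' hreg' hx' (ρ w₀)
  have hcurve : ∀ ν : ℝ, slotPerm ρ (p + ν • nrm w₀) =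
      slotPerm (Function.update (1 : {w : InfinitePlace L // IsComplex w} → Perm (Fin 3)) w₀ (ρ w₀)) (slotPerm (Function.update ρ w₀ 1) p + ν • nrm w₀) := fun ν => by
    rw [slotPerm_eq_slotPerm_update_one ρ w₀, slotPerm_add_smul_nrm_of_apply_eq_one h1]
  simp only [hcurve]
  rw [cayPt_slotPerm_of_apply_eq_one h1 p] at hsix
  refine HasOneSidedJump.jump_congr (HasOneSidedJump.const_mul _ hsix) ?_
  split_ifs with hA
  · rw [kappa_eq_sign_mul_kappa_update L α h10 ρ hA]
    have hsq : (Equiv.Perm.sign (ρ w₀) : ℂ) * (Equiv.Perm.sign (ρ w₀) : ℂ) = 1 := by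
      rcases Int.units_eq_one_or (Equiv.Perm.sign (ρ w₀)) with h | h <;> simp [h]
    linear_combination (jc' S w₀ 0 2 *
      ((((∏ w : {w : InfinitePlace L // IsComplex w},
          ((SignType.sign ((w.1.embedding (α (lineOf (formSign L α w) ((Function.update ρ w₀ 1 w).symm 1)))).re) : ℤ) *
            archMajoritySign L (Matrix.diagonal α) w) : ℤ) : ℂ) *
        ∏ w : {w : InfinitePlace L // IsComplex w}, (Equiv.Perm.sign (Function.update ρ w₀ 1 w) : ℂ)) *
      (archERhoG (insert w₀ S) (slotPerm (Function.update ρ w₀ 1) (cayPt w₀ p)) * F (insert w₀ S) (slotPerm (Function.update ρ w₀ 1) (cayPt w₀ p))))) * hsq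
  · rw [mul_zero]

omit [IsCMField L] in
/-- **THE RESOLVED PARTNER SUM JUMPS BY `4 · jc′ S w₀ 0 2 · Σ″(cayPt w₀ p)`**, `Σ″(q) = Σ_{ρ′ ∈ partnerPerms (insert w₀ S)} κ_{ρ′} · 'F_{S″}(ρ′·q)`: four jumping classes per `ρ′`, each
contributing `+κ_{ρ′}·jc′₀₂·'F_{S″}(ρ′·q)` (§2 `sum_partnerPerms_ite_symm_one_ne_two`). [cite: Shelstad1979, Thm. 4.7 (IIIb) p. 31] [cite: Bouaziz1994IntegralesOrbitales, Rem. 2 p. 594] -/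
theorem hasOneSidedJump_resolvedSum (hα : ∀ i, α i ≠ 0) {S : Finset {w : InfinitePlace L // IsComplex w}}
    {w₀ : {w : InfinitePlace L // IsComplex w}} (hw₀ : w₀ ∉ S) (hcov : w₀ ∈ splitChartPlaces L α)
    {jc' : Finset {w : InfinitePlace L // IsComplex w} → {w : InfinitePlace L // IsComplex w} → Fin 3 → Fin 3 → ℂ}
    {F : Finset {w : InfinitePlace L // IsComplex w} → ({w : InfinitePlace L // IsComplex w} → Fin 3 → ℝ) → ℂ} (hF : ArchHCSpaceG (slotSign L α) jc' F)
    {p : {w : InfinitePlace L // IsComplex w} → Fin 3 → ℝ} (hs02 : p w₀ 0 = p w₀ 2) (hs1 : Circle.exp (p w₀ 1) ≠ Circle.exp (p w₀ 0))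
    (hreg : ∀ v, v ∉ S → v ≠ w₀ → Function.Injective fun i : Fin 3 => Circle.exp (p v i)) (hx : ∀ v ∈ S, p v 0 ≠ 0) :
    HasOneSidedJump
      (fun ν : ℝ => ∑ ρ ∈ partnerPerms S,
        (((∏ w : {w : InfinitePlace L // IsComplex w},
            ((SignType.sign ((w.1.embedding (α (lineOf (formSign L α w) ((ρ w).symm 1)))).re) : ℤ) * archMajoritySign L (Matrix.diagonal α) w) : ℤ) : ℂ) *
          ∏ w : {w : InfinitePlace L // IsComplex w}, (Equiv.Perm.sign (ρ w) : ℂ)) *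
        (archERhoG S (slotPerm ρ (p + ν • nrm w₀)) * F S (slotPerm ρ (p + ν • nrm w₀))))
      (4 * (jc' S w₀ 0 2 * ∑ ρ' ∈ partnerPerms (insert w₀ S),
        (((∏ w : {w : InfinitePlace L // IsComplex w},
            ((SignType.sign ((w.1.embedding (α (lineOf (formSign L α w) ((ρ' w).symm 1)))).re) : ℤ) * archMajoritySign L (Matrix.diagonal α) w) : ℤ) : ℂ) *
          ∏ w : {w : InfinitePlace L // IsComplex w}, (Equiv.Perm.sign (ρ' w) : ℂ)) *
        (archERhoG (insert w₀ S) (slotPerm ρ' (cayPt w₀ p)) * F (insert w₀ S) (slotPerm ρ' (cayPt w₀ p))))) := by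
  refine HasOneSidedJump.jump_congr (hasOneSidedJump_sum (partnerPerms S) fun ρ hρ =>
    hasOneSidedJump_kappa_twisted_partner L α hα hw₀ hcov hF hs02 hs1 hreg hx hρ) ?_
  have key := sum_partnerPerms_ite_symm_one_ne_two hw₀ (fun ρ' : {w : InfinitePlace L // IsComplex w} → Perm (Fin 3) => jc' S w₀ 0 2 *
    ((((∏ w : {w : InfinitePlace L // IsComplex w},
        ((SignType.sign ((w.1.embedding (α (lineOf (formSign L α w) ((ρ' w).symm 1)))).re) : ℤ) * archMajoritySign L (Matrix.diagonal α) w) : ℤ) : ℂ) *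
      ∏ w : {w : InfinitePlace L // IsComplex w}, (Equiv.Perm.sign (ρ' w) : ℂ)) *
    (archERhoG (insert w₀ S) (slotPerm ρ' (cayPt w₀ p)) * F (insert w₀ S) (slotPerm ρ' (cayPt w₀ p)))))
  exact key.trans (by rw [← Finset.mul_sum])

end Kappa

end Literature.NumberTheory.Rogawski1990

end
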